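import Mathlib
import Summits.Ventures.HodgeRepro.Tier4.Common.HoloEstimates
import Summits.Ventures.HodgeRepro.Tier4.Common.HeckeRegularity
import Summits.Ventures.HodgeRepro.Tier4.Common.HoloForms

/-!
# Tier4/Common/HoloTransfer — forms of `X_{Γ′}` are determined by their values on a fundamental domain, and a bound
on the domain transfers to a bound on a larger ball through finitely many `γ`

Blind re-derivation cell `pub-hodge-repro`, Tier 4 (README §9–§10), seat t4-typer-1 (gen 1).  Target tree path
`lean/Summits/Ventures/HodgeRepro/Tier4/Common/HoloTransfer.lean`.  Imports `HoloEstimates` (typer-1 g1: `cball`,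
`oball`, `forall_norm_le_of_ae`), `HeckeRegularity` (typer-1 g0: `differentiableOn_jacMat_actM`,
`differentiableOn_jacDetMap_actM`), `HoloForms` (`IsHoloForm`).

WHY.  Towards (T2) — the finite-dimensionality of the holomorphic forms of the compact quotient `X_{Γ′}`
(`Tier4/Common/HoloFinite.lean`).  Two facts about a holomorphic form `x = (G, h)` of `X_{Γ′}` (a `Γ′`-invariant pair
on the ball, `pullField (act γ) G = G`, `pullCoeff (act γ) h = h`):
* **injectivity** (`eq_zero_of_eqOn_domain`): if `x` vanishes on a measurable fundamental domain `D`, it vanishes —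
  almost every point of the ball has a `Γ′`-translate in `D`, the invariance carries the zero back, and a continuous
  function vanishing a.e. on the open ball vanishes on it;
* **bound transfer** (`forall_norm_le_of_domain`): if `‖x‖ ≤ c` on `D ⊆ {nsq ≤ r₂}` and only FINITELY many `γ ∈ Γ′`
  move `{nsq ≤ r₂}` into itself (the proper discontinuity of the ball action — the printed input
  `Lit.BorelHarishChandra1962_properlyDiscontinuous_hdef`, consumed in `HoloFinite`), then `‖x‖ ≤ J c` on
  `{nsq < r₂}`, where `J` bounds the Jacobian weights `Σ_{j,k} |∂_k (γ·z)_j| + |det D(γ·)(z)|` of those finitely many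
  `γ` on the compact `{nsq ≤ r₂}` (they are continuous on the ball).

Nothing here says anything about the status of the Hodge conjecture for CM abelian varieties, which is NOT proved
(HC_CM is NOT proved by anyone in this repository).
-/

set_option autoImplicit false

noncomputable section

open Matrix MeasureTheory NumberField Set
open scoped ComplexConjugate ComplexOrder

namespace Summit.Ventures.HodgeRepro.Tier4

open Summit.Ventures.HodgeRepro.Tier4.Common

/-- `‖Mᵀ v‖ ≤ (Σ_{j,k} ‖M j k‖) ‖v‖` (sup norms on `Fin 2 → ℂ`). -/
theorem norm_transpose_mulVec_le (M : Matrix (Fin 2) (Fin 2) ℂ) (v : Fin 2 → ℂ) :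
    ‖Mᵀ *ᵥ v‖ ≤ (∑ j, ∑ k, ‖M j k‖) * ‖v‖ := by
  have hS : 0 ≤ ∑ j, ∑ k, ‖M j k‖ := Finset.sum_nonneg fun j _ => Finset.sum_nonneg fun k _ => norm_nonneg _
  rw [pi_norm_le_iff_of_nonneg (mul_nonneg hS (norm_nonneg v))]
  intro k
  simp only [Matrix.mulVec, Matrix.transpose_apply, dotProduct]
  calc ‖∑ j, M j k * v j‖ ≤ ∑ j, ‖M j k * v j‖ := norm_sum_le _ _
    _ ≤ ∑ j, ‖M j k‖ * ‖v‖ := Finset.sum_le_sum fun j _ => by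
        rw [norm_mul]
        exact mul_le_mul_of_nonneg_left (norm_le_pi_norm v j) (norm_nonneg _)
    _ = (∑ j, ‖M j k‖) * ‖v‖ := by rw [Finset.sum_mul]
    _ ≤ (∑ j, ∑ k', ‖M j k'‖) * ‖v‖ := by
        refine mul_le_mul_of_nonneg_right (Finset.sum_le_sum fun j _ => ?_) (norm_nonneg v)
        exact Finset.single_le_sum (fun k' _ => norm_nonneg (M j k')) (Finset.mem_univ k)

namespace TargetData

variable {F E : Type} [Field F] [NumberField F] [IsGalois ℚ F] [IsCMField F]
  [Field E] [NumberField E] [IsGalois ℚ E] [IsCMField E] (d : TargetData F E)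

/-! ## The Jacobian weight of `γ` and the pointwise invariance bounds -/

/-- The Jacobian weight of `γ` at `z`: `Σ_{j,k} ‖∂_k (γ·z)_j‖ + ‖det D(γ·)(z)‖` — the factor by which the invariance
`x(z) = (Dγ)ᵀ x(γz)` / `h(z) = h(γz) · det Dγ` can inflate a bound at `γ z` into a bound at `z`. -/
def jacWeight (γ : Matrix (Fin 3) (Fin 3) E) (z : Fin 2 → ℂ) : ℝ :=
  (∑ j, ∑ k, ‖jacMat (d.act γ) z j k‖) + ‖jacDetMap (d.act γ) z‖

/-- The Jacobian weight of `γ ∈ Γ` is continuous on the ball. -/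
theorem continuousOn_jacWeight {γ : Matrix (Fin 3) (Fin 3) E} (hγ : γ ∈ d.Γ) :
    ContinuousOn (d.jacWeight γ) ball := by
  have hU := d.toBallMat_mem_U21 hγ
  refine ContinuousOn.add (continuousOn_finsetSum _ fun j _ => continuousOn_finsetSum _ fun k _ => ?_) ?_
  · exact (differentiableOn_jacMat_actM hU j k).continuousOn.norm
  · exact (differentiableOn_jacDetMap_actM hU).continuousOn.norm

/-- The `1`-form invariance bounds `‖G z‖` by the weight of `γ` times `‖G (γ z)‖`. -/
theorem norm_fst_le_of_act {Γ' : Set (Matrix (Fin 3) (Fin 3) E)} {G : (Fin 2 → ℂ) → (Fin 2 → ℂ)}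
    (hG : d.IsAutForm1 Γ' G) {γ : Matrix (Fin 3) (Fin 3) E} (hγ : γ ∈ Γ') {z : Fin 2 → ℂ} (hz : z ∈ ball) :
    ‖G z‖ ≤ d.jacWeight γ z * ‖G (d.act γ z)‖ := by
  have h := hG.2 γ hγ z hz
  calc ‖G z‖ = ‖pullField (d.act γ) G z‖ := by rw [h]
    _ = ‖(jacMat (d.act γ) z)ᵀ *ᵥ G (d.act γ z)‖ := rfl
    _ ≤ (∑ j, ∑ k, ‖jacMat (d.act γ) z j k‖) * ‖G (d.act γ z)‖ := norm_transpose_mulVec_le _ _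
    _ ≤ d.jacWeight γ z * ‖G (d.act γ z)‖ := by
        refine mul_le_mul_of_nonneg_right ?_ (norm_nonneg _)
        unfold jacWeight
        linarith [norm_nonneg (jacDetMap (d.act γ) z)]

/-- The `2`-form invariance bounds `‖h z‖` by the weight of `γ` times `‖h (γ z)‖`. -/
theorem norm_snd_le_of_act {Γ' : Set (Matrix (Fin 3) (Fin 3) E)} {h : (Fin 2 → ℂ) → ℂ}
    (hh : d.IsAutForm2 Γ' h) {γ : Matrix (Fin 3) (Fin 3) E} (hγ : γ ∈ Γ') {z : Fin 2 → ℂ} (hz : z ∈ ball) :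
    ‖h z‖ ≤ d.jacWeight γ z * ‖h (d.act γ z)‖ := by
  have e := hh.2 γ hγ z hz
  calc ‖h z‖ = ‖pullCoeff (d.act γ) h z‖ := by rw [e]
    _ = ‖h (d.act γ z)‖ * ‖jacDetMap (d.act γ) z‖ := by rw [pullCoeff, norm_mul]
    _ ≤ ‖h (d.act γ z)‖ * d.jacWeight γ z := by
        refine mul_le_mul_of_nonneg_left ?_ (norm_nonneg _)
        unfold jacWeight
        have : 0 ≤ ∑ j, ∑ k, ‖jacMat (d.act γ) z j k‖ :=
          Finset.sum_nonneg fun j _ => Finset.sum_nonneg fun k _ => norm_nonneg _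
        linarith
    _ = d.jacWeight γ z * ‖h (d.act γ z)‖ := mul_comm _ _

/-! ## Almost every point of the ball has a `Γ′`-translate in the fundamental domain -/

/-- Almost every point of the ball has a `Γ′`-translate in `D` (the covering clause of `IsFundamentalDomainFor`). -/
theorem ae_exists_act_mem {Γ' : Set (Matrix (Fin 3) (Fin 3) E)} {D : Set (Fin 2 → ℂ)} (hDom : d.IsDomain Γ' D) :
    ∀ᵐ z ∂(volume.restrict ball), ∃ γ ∈ Γ', d.act γ z ∈ D := by
  filter_upwards [hDom.2.2.1] with z hz
  obtain ⟨φ, ⟨γ, hγ, rfl⟩, hφ⟩ := hz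
  exact ⟨γ, hγ, hφ⟩

/-! ## Injectivity: a form of `X_{Γ′}` vanishing on `D` vanishes -/

/-- **A holomorphic form of `X_{Γ′}` vanishing on a fundamental domain is zero.** -/
theorem eq_zero_of_eqOn_domain {Γ' : Set (Matrix (Fin 3) (Fin 3) E)} {D : Set (Fin 2 → ℂ)} (hDom : d.IsDomain Γ' D)
    {x : FormPair} (hx : d.IsHoloForm Γ' D x) (h1 : ∀ z ∈ D, x.1 z = 0) (h2 : ∀ z ∈ D, x.2 z = 0) : x = 0 := by
  have hae1 : ∀ᵐ z ∂(volume.restrict ball), ‖x.1 z‖ ≤ 0 := by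
    filter_upwards [d.ae_exists_act_mem hDom, ae_restrict_mem isOpen_ball.measurableSet] with z hz hzb
    obtain ⟨γ, hγ, hγz⟩ := hz
    calc ‖x.1 z‖ ≤ d.jacWeight γ z * ‖x.1 (d.act γ z)‖ := d.norm_fst_le_of_act hx.1.1 hγ hzb
      _ = 0 := by rw [h1 _ hγz, norm_zero, mul_zero]
  have hae2 : ∀ᵐ z ∂(volume.restrict ball), ‖x.2 z‖ ≤ 0 := by
    filter_upwards [d.ae_exists_act_mem hDom, ae_restrict_mem isOpen_ball.measurableSet] with z hz hzb
    obtain ⟨γ, hγ, hγz⟩ := hz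
    calc ‖x.2 z‖ ≤ d.jacWeight γ z * ‖x.2 (d.act γ z)‖ := d.norm_snd_le_of_act hx.1.2.1 hγ hzb
      _ = 0 := by rw [h2 _ hγz, norm_zero, mul_zero]
  have hall1 := forall_norm_le_of_ae isOpen_ball hx.2.1.continuousOn hae1
  have hall2 := forall_norm_le_of_ae isOpen_ball hx.2.2.continuousOn hae2
  refine Prod.ext (funext fun z => ?_) (funext fun z => ?_)
  · by_cases hz : z ∈ ball
    · exact norm_le_zero_iff.1 (hall1 z hz)
    · exact hx.1.1.1 z hz
  · by_cases hz : z ∈ ball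
    · exact norm_le_zero_iff.1 (hall2 z hz)
    · exact hx.1.2.1.1 z hz

/-! ## Bound transfer through finitely many `γ` -/

/-- The Jacobian weights of a finite set of `γ ∈ Γ′` are uniformly bounded on a compact subset of the ball. -/
theorem exists_jacBound {Γ' : Set (Matrix (Fin 3) (Fin 3) E)} (hΓ' : d.IsLevel Γ')
    {S : Set (Matrix (Fin 3) (Fin 3) E)} (hS : S.Finite) (hSΓ : S ⊆ Γ') {K : Set (Fin 2 → ℂ)} (hK : IsCompact K)
    (hKb : K ⊆ ball) : ∃ J : ℝ, 0 ≤ J ∧ ∀ γ ∈ S, ∀ z ∈ K, d.jacWeight γ z ≤ J := by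
  have hC : ∀ γ : Matrix (Fin 3) (Fin 3) E, ∃ C : ℝ, γ ∈ S → ∀ z ∈ K, d.jacWeight γ z ≤ C := by
    intro γ
    by_cases hγ : γ ∈ S
    · obtain ⟨C, hC⟩ :=
        hK.exists_bound_of_continuousOn ((d.continuousOn_jacWeight (hΓ'.2 (hSΓ hγ))).mono hKb)
      refine ⟨C, fun _ z hz => ?_⟩
      have := hC z hz
      rw [Real.norm_eq_abs] at this
      exact (le_abs_self _).trans this
    · exact ⟨0, fun h => absurd h hγ⟩
  choose C hC using hC
  obtain ⟨J, hJ⟩ := (hS.image C).bddAbove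
  refine ⟨max J 0, le_max_right _ _, fun γ hγ z hz => ?_⟩
  exact (hC γ hγ z hz).trans ((hJ ⟨γ, hγ, rfl⟩).trans (le_max_left _ _))

/-- **Bound transfer.**  Let `D ⊆ {nsq ≤ r₂}` be a fundamental domain of `Γ′` (`r₂ < 1`) and suppose only finitely
many `γ ∈ Γ′` move `{nsq ≤ r₂}` into itself.  Then there is `J ≥ 0` such that every holomorphic form `x` of `X_{Γ′}`
with `‖x‖ ≤ c` on `D` has `‖x‖ ≤ J c` on the open ball `{nsq < r₂}`. -/
theorem forall_norm_le_of_domain {Γ' : Set (Matrix (Fin 3) (Fin 3) E)} (hΓ' : d.IsLevel Γ') {D : Set (Fin 2 → ℂ)}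
    (hDom : d.IsDomain Γ' D) {r₂ : ℝ} (hr₂ : r₂ < 1) (hDK : D ⊆ cball r₂)
    (hpd : {γ ∈ Γ' | ∃ z ∈ cball r₂, d.act γ z ∈ cball r₂}.Finite) :
    ∃ J : ℝ, 0 ≤ J ∧ ∀ x : FormPair, d.IsHoloForm Γ' D x → ∀ c : ℝ, (∀ z ∈ D, ‖x.1 z‖ ≤ c ∧ ‖x.2 z‖ ≤ c) →
      ∀ z ∈ oball r₂, ‖x.1 z‖ ≤ J * c ∧ ‖x.2 z‖ ≤ J * c := by
  obtain ⟨J, hJ0, hJ⟩ :=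
    d.exists_jacBound hΓ' hpd (fun γ hγ => hγ.1) (isCompact_cball r₂) (cball_subset_ball hr₂)
  refine ⟨J, hJ0, fun x hx c hc => ?_⟩
  have hae : ∀ᵐ z ∂(volume.restrict (oball r₂)), ‖x.1 z‖ ≤ J * c ∧ ‖x.2 z‖ ≤ J * c := by
    have hcov := ae_restrict_of_ae_restrict_of_subset (oball_subset_ball hr₂.le) (d.ae_exists_act_mem hDom)
    filter_upwards [hcov, ae_restrict_mem (isOpen_oball r₂).measurableSet] with z hz hzU
    obtain ⟨γ, hγ, hγz⟩ := hz
    have hzb : z ∈ ball := oball_subset_ball hr₂.le hzU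
    have hγS : γ ∈ {γ ∈ Γ' | ∃ z ∈ cball r₂, d.act γ z ∈ cball r₂} :=
      ⟨hγ, z, oball_subset_cball r₂ hzU, hDK hγz⟩
    have hw := hJ γ hγS z (oball_subset_cball r₂ hzU)
    constructor
    · calc ‖x.1 z‖ ≤ d.jacWeight γ z * ‖x.1 (d.act γ z)‖ := d.norm_fst_le_of_act hx.1.1 hγ hzb
        _ ≤ J * c := mul_le_mul hw (hc _ hγz).1 (norm_nonneg _) hJ0
    · calc ‖x.2 z‖ ≤ d.jacWeight γ z * ‖x.2 (d.act γ z)‖ := d.norm_snd_le_of_act hx.1.2.1 hγ hzb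
        _ ≤ J * c := mul_le_mul hw (hc _ hγz).2 (norm_nonneg _) hJ0
  have h1 := forall_norm_le_of_ae (isOpen_oball r₂) (hx.2.1.continuousOn.mono (oball_subset_ball hr₂.le))
    (hae.mono fun z hz => hz.1)
  have h2 := forall_norm_le_of_ae (isOpen_oball r₂) (hx.2.2.continuousOn.mono (oball_subset_ball hr₂.le))
    (hae.mono fun z hz => hz.2)
  exact fun z hz => ⟨h1 z hz, h2 z hz⟩

end TargetData

end Summit.Ventures.HodgeRepro.Tier4
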